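import Summits.ResolutionOfSingularities.ResolutionOfSingularities.Theorems.WeightedInvariantStalkRecipeSmoothInvariance
import Summits.ResolutionOfSingularities.ResolutionOfSingularities.Theorems.WeightedInvariantSingularLocusHomogeneous
import Summits.ResolutionOfSingularities.ResolutionOfSingularities.Theorems.WeightedInvariantHypersurfaceLocalGameEFT3
import Summits.ResolutionOfSingularities.ResolutionOfSingularities.Theorems.WeightedInvariantHypersurfaceCentreAssemblyDefs
import Literature.AlgebraicGeometry.Resolution.Principalization
import HarnessLib

/-!
# The canonical centre of the H2c″ door assembly is homogeneous on every torus chart of the pair ([S5])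

Route `ResolutionOfSingularities/WeightedInvariant`, door crux `HypersurfaceCentreConstruction`
(stmt-ResolutionOfSingularities-19897), H2c″ assembly of stub-9 = res-D-brk-1 (`Theorems/…HypersurfaceCentreAssemblyDefs.lean`,
p501564: `localGenerator`, `iotaAt`, `iotaMax`, `maxLocus`, `IsCanonicalCentre`) over plan-1's H2a‴ clause module
(`Theorems/…HypersurfaceLocalGameEFT3.lean`: (c6) `IotaIsoInvariant`, (c10) `IotaTorusFactorMonotone`, (c11)
`IotaJEssSmoothCompatible`, `JIsoInvariant`, (c12a) `IotaUnitInvariant` / `JUnitInvariant`). This file proves the CONTENT of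
sub-stub [S5] (summit-side helper, OURS; the by-name closer `stub_isHomogeneous_of_isCanonicalCentre` follows in a 3-line
file once door skeleton v3 registers the stub over these tree constants):

* `exists_stalkIdeal_eq_span_of_isLocallyPrincipal` — stalks of a locally principal ideal sheaf are principal;
* `iotaAt_comap_eq_and_J_comap_eq` — along a smooth `g : T → Y` (`Y` regular locally Noetherian, `X` locally principal):
  `ι_t(g*X) = ι_{g t}(X)` and `J(𝒪_{T,t}, f′_t)_n = J(𝒪_{Y,g t}, f_{g t})_n · 𝒪_{T,t}` — (c11) on the stalk map
  (`stalkMap_smooth_data`: local, formally smooth, essentially of finite type between regular local rings) + (c12a) for the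
  two local equations `φ(f_{g t})`, `f′_t`, which generate the same principal ideal and differ by a unit;
* `isHomogeneous_of_isCanonicalCentre` — **[S5] with the (c12a) clauses as hypotheses**: for a canonical centre `R` of a
  singular hypersurface pair `(f : Y → Spec k, X)` and every affine `W` with a `ℤʲ`-grading making `X(W)` homogeneous, every
  `Rₙ(W)` is homogeneous. Proof: the pieces of `R` are determined by `X` along smooth morphisms from affine schemes — membership
  of `g t` in the maximum locus reads on `T` through `g*X` (`preimage_singSet_eq_of_smooth` for the non-regular locus, the item
  above for `ι`), and so do the stalks (`IsCanonicalCentre.stalkIdeal_eq/_eq_top`) — hence homogeneous by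
  `isHomogeneous_ideal_of_forall_comap_eq_of_smooth` (p500380). The hypotheses `hc6`, `hc10`, `hJ`, `hXi`, `hsing`, `h0` of the
  sketch's signature are carried and not used.

AI-written; weaker than expert review. [cite: Wlodarczyk2022, Thm. 1.1.4 (6)]
-/

noncomputable section

set_option linter.dupNamespace false -- mandated namespace of this single-conjunct summit

open CategoryTheory AlgebraicGeometry TopologicalSpace IsLocalRing
open Literature.AlgebraicGeometry.Resolution

namespace Summit.ResolutionOfSingularities.ResolutionOfSingularities.Theorems

open Summit.ResolutionOfSingularities.ResolutionOfSingularities.Cruxes.HypersurfaceCentreConstruction.LocalEngine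



/-! ## Local equations and their pull-backs -/

section LocalGenerator

/-- The stalks of a locally principal ideal sheaf are principal. [folklore] -/
theorem exists_stalkIdeal_eq_span_of_isLocallyPrincipal {Y : Scheme.{0}} {X : Y.IdealSheafData}
    (hX : IsLocallyPrincipal X) (y : Y) : ∃ g : Y.presheaf.stalk y, stalkIdeal X y = Ideal.span {g} := by
  obtain ⟨U, hyU, f, hf⟩ := hX y
  refine ⟨(Y.presheaf.germ U y hyU).hom f, ?_⟩
  rw [stalkIdeal_eq_map_germ X U hyU, hf, Ideal.map_span, Set.image_singleton]

end LocalGenerator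

/-! ## [S5] (content) -/

section S5

variable {p : ℕ} (ι : (R : Type) → [CommRing R] → R → Ordinal.{0})
  (J : (R : Type) → [CommRing R] → R → ℕ → Ideal R)

/-- **Transport of the local data along the stalk map of a smooth morphism.** For `Y` regular locally Noetherian,
`g : T → Y` smooth, `X` locally principal on `Y`, and `t ∈ T` with `g t ∈ Supp X`: the pulled-back local equation
`φ(f_{g t})` is a unit multiple of the local equation of `g*X` at `t`, hence (c11) + unit-invariance give
`ι_t(g*X) = ι_{g t}(X)` and `J(𝒪_{T,t}, f'_t)_n = J(𝒪_{Y,g t}, f_{g t})_n · 𝒪_{T,t}`. [folklore] -/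
theorem iotaAt_comap_eq_and_J_comap_eq (hJs : IotaJEssSmoothCompatible ι J) (hu : IotaUnitInvariant ι)
    (hJu : JUnitInvariant J) {Y T : Scheme.{0}} [IsLocallyNoetherian Y] (hY : Scheme.IsRegular Y)
    (g : T ⟶ Y) [Smooth g] (X : Y.IdealSheafData) (hX : IsLocallyPrincipal X) (t : T) :
    iotaAt ι (X.comap g) t = iotaAt ι X (g t) ∧
      ∀ n, J (T.presheaf.stalk t) (localGenerator (X.comap g) t) n =
        (J (Y.presheaf.stalk (g t)) (localGenerator X (g t)) n).map (g.stalkMap t).hom := by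
  letI : Algebra (Y.presheaf.stalk (g t)) (T.presheaf.stalk t) := (g.stalkMap t).hom.toAlgebra
  obtain ⟨h1, h2, h3, h4, h5⟩ := stalkMap_smooth_data hY g t
  haveI := h1; haveI := h2; haveI := h3; haveI := h4; haveI := h5
  haveI : IsDomain (T.presheaf.stalk t) := isDomain_of_isRegularLocalRing _
  set fy := localGenerator X (g t) with hfy
  set ft := localGenerator (X.comap g) t with hft
  have hXy : stalkIdeal X (g t) = Ideal.span {fy} :=
    stalkIdeal_eq_span_localGenerator X (g t) (exists_stalkIdeal_eq_span_of_isLocallyPrincipal hX (g t))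
  have hXt' : stalkIdeal (X.comap g) t = Ideal.span {(g.stalkMap t).hom fy} := by
    rw [stalkIdeal_comap_eq_map_stalkMap, hXy, Ideal.map_span, Set.image_singleton]
  have hXt : stalkIdeal (X.comap g) t = Ideal.span {ft} :=
    stalkIdeal_eq_span_localGenerator (X.comap g) t ⟨_, hXt'⟩
  -- the two generators of the principal ideal `(g*X)_t` differ by a unit
  have hassoc : Associated ((g.stalkMap t).hom fy) ft := by
    rw [← Ideal.span_singleton_eq_span_singleton, ← hXt', hXt]
  obtain ⟨v, hv⟩ := hassoc
  have hφ : algebraMap (Y.presheaf.stalk (g t)) (T.presheaf.stalk t) fy = (g.stalkMap t).hom fy := rfl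
  obtain ⟨hι, hJ⟩ := hJs (Y.presheaf.stalk (g t)) (T.presheaf.stalk t) fy
  constructor
  · -- `ι`
    rw [iotaAt, iotaAt, ← hft, ← hfy, ← hι, hφ, ← hv, mul_comm, hu _ _ _ v.isUnit]
  · intro n
    rw [← hv, mul_comm, hJu _ _ _ _ v.isUnit]
    change J _ (algebraMap _ _ fy) n = _
    rw [hJ n]
    rfl

/-- **[S5]: the canonical centre is homogeneous on every torus chart of the pair** — the sketch's signature with the
(c12a) unit clauses `hu`, `hJu` ADDED (needed: the two pulled-back local equations along the two torus-chart
maps generate the same principal ideal and differ by a unit). Proof: the pieces of the canonical centre are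
determined by `X` along smooth morphisms from affine schemes (stalkwise, using `preimage_singSet_eq_of_smooth` for
the non-regular locus, (c11) along the stalk maps `stalkMap_smooth_data`, unit-invariance for the choice of local
equation), hence homogeneous by `isHomogeneous_ideal_of_forall_comap_eq_of_smooth`. [cite: Wlodarczyk2022, Thm. 1.1.4 (6)] -/
theorem isHomogeneous_of_isCanonicalCentre (_hc6 : IotaIsoInvariant ι) (_hc10 : IotaTorusFactorMonotone ι)
    (_hJ : JIsoInvariant J) (hJs : IotaJEssSmoothCompatible ι J) (hu : IotaUnitInvariant ι) (hJu : JUnitInvariant J)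
    {k : Type} [Field k] [CharP k p] [PerfectField k] {Y : Scheme.{0}} (f : Y ⟶ Spec (.of k)) [Smooth f]
    [IsSeparated f] [QuasiCompact f] (X : Y.IdealSheafData) (hX : IsLocallyPrincipal X)
    (_hXi : IsIntegral X.subscheme) (_hsing : ¬ Scheme.IsRegular X.subscheme)
    (R : ReesAlgebraData Y) (hR : IsCanonicalCentre ι J X R)
    {j : ℕ} (W : Y.affineOpens) (𝒢 : (Fin j → ℤ) → AddSubgroup Γ(Y, W)) [GradedRing 𝒢]
    (_h0 : ∀ c : Γ(Spec (.of k), ⊤), f.appLE ⊤ W le_top c ∈ 𝒢 0) (hXhom : (X.ideal W).IsHomogeneous 𝒢) (n : ℕ) :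
    ((R.piece n).ideal W).IsHomogeneous 𝒢 := by
  haveI : IsLocallyNoetherian Y := LocallyOfFiniteType.isLocallyNoetherian f
  have hY : Scheme.IsRegular Y := Scheme.IsRegular.of_smooth f (Scheme.isRegular_Spec (.of k))
  refine isHomogeneous_ideal_of_forall_comap_eq_of_smooth X (R.piece n) (fun T _ g₁ g₂ _ _ hg => ?_) W 𝒢 hXhom
  -- membership in the maximum locus is read on `T` through `g*X` only
  have hmem : ∀ (g : T ⟶ Y) [Smooth g] (t : T), g t ∈ maxLocus ι X ↔
      t ∈ singImage (X.comap g) ∧ iotaAt ι (X.comap g) t = iotaMax ι X := by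
    intro g _ t
    have hsing : g t ∈ singImage X ↔ t ∈ singImage (X.comap g) := by
      change t ∈ g ⁻¹' singImage X ↔ _
      rw [show g ⁻¹' singImage X = singImage (X.comap g) from preimage_singSet_eq_of_smooth g X]
    rw [maxLocus, Set.mem_setOf_eq, hsing, (iotaAt_comap_eq_and_J_comap_eq ι J hJs hu hJu hY g X hX t).1]
  refine ext_of_forall_stalkIdeal_eq fun t => ?_
  rw [stalkIdeal_comap_eq_map_stalkMap g₁, stalkIdeal_comap_eq_map_stalkMap g₂]
  by_cases ht : t ∈ singImage (X.comap g₁) ∧ iotaAt ι (X.comap g₁) t = iotaMax ι X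
  · -- both `g₁ t` and `g₂ t` lie on the maximum locus
    have h₁ : g₁ t ∈ maxLocus ι X := (hmem g₁ t).mpr ht
    have h₂ : g₂ t ∈ maxLocus ι X := (hmem g₂ t).mpr (hg ▸ ht)
    rw [hR.stalkIdeal_eq _ h₁ n, hR.stalkIdeal_eq _ h₂ n,
      ← (iotaAt_comap_eq_and_J_comap_eq ι J hJs hu hJu hY g₁ X hX t).2 n,
      ← (iotaAt_comap_eq_and_J_comap_eq ι J hJs hu hJu hY g₂ X hX t).2 n, hg]
  · have h₁ : g₁ t ∉ maxLocus ι X := fun h => ht ((hmem g₁ t).mp h)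
    have h₂ : g₂ t ∉ maxLocus ι X := fun h => ht (hg ▸ (hmem g₂ t).mp h)
    rw [hR.stalkIdeal_eq_top _ h₁ n, hR.stalkIdeal_eq_top _ h₂ n, Ideal.map_top, Ideal.map_top]

/-- **[S5] with MINIMAL hypotheses** (the ones the proof uses: (c11), (c12a), `f` smooth, `X` locally principal, `R` canonical):
on every affine `W` with a `ℤʲ`-grading making `X(W)` homogeneous, every piece `Rₙ(W)` of a canonical centre is homogeneous.
This is the form the by-name closer of door skeleton v3's `stub_isHomogeneous_of_isCanonicalCentre` (hypotheses `hc6 hu hJ hJu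
hJs`, no `hc10`) calls. Same proof as `isHomogeneous_of_isCanonicalCentre`. [cite: Wlodarczyk2022, Thm. 1.1.4 (6)] -/
theorem isHomogeneous_of_isCanonicalCentre' (hJs : IotaJEssSmoothCompatible ι J) (hu : IotaUnitInvariant ι)
    (hJu : JUnitInvariant J) {k : Type} [Field k] {Y : Scheme.{0}} (f : Y ⟶ Spec (.of k)) [Smooth f]
    (X : Y.IdealSheafData) (hX : IsLocallyPrincipal X) (R : ReesAlgebraData Y) (hR : IsCanonicalCentre ι J X R)
    {j : ℕ} (W : Y.affineOpens) (𝒢 : (Fin j → ℤ) → AddSubgroup Γ(Y, W)) [GradedRing 𝒢]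
    (hXhom : (X.ideal W).IsHomogeneous 𝒢) (n : ℕ) : ((R.piece n).ideal W).IsHomogeneous 𝒢 := by
  haveI : IsLocallyNoetherian Y := LocallyOfFiniteType.isLocallyNoetherian f
  have hY : Scheme.IsRegular Y := Scheme.IsRegular.of_smooth f (Scheme.isRegular_Spec (.of k))
  refine isHomogeneous_ideal_of_forall_comap_eq_of_smooth X (R.piece n) (fun T _ g₁ g₂ _ _ hg => ?_) W 𝒢 hXhom
  -- membership in the maximum locus is read on `T` through `g*X` only
  have hmem : ∀ (g : T ⟶ Y) [Smooth g] (t : T), g t ∈ maxLocus ι X ↔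
      t ∈ singImage (X.comap g) ∧ iotaAt ι (X.comap g) t = iotaMax ι X := by
    intro g _ t
    have hsing : g t ∈ singImage X ↔ t ∈ singImage (X.comap g) := by
      change t ∈ g ⁻¹' singImage X ↔ _
      rw [show g ⁻¹' singImage X = singImage (X.comap g) from preimage_singSet_eq_of_smooth g X]
    rw [maxLocus, Set.mem_setOf_eq, hsing, (iotaAt_comap_eq_and_J_comap_eq ι J hJs hu hJu hY g X hX t).1]
  refine ext_of_forall_stalkIdeal_eq fun t => ?_
  rw [stalkIdeal_comap_eq_map_stalkMap g₁, stalkIdeal_comap_eq_map_stalkMap g₂]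
  by_cases ht : t ∈ singImage (X.comap g₁) ∧ iotaAt ι (X.comap g₁) t = iotaMax ι X
  · -- both `g₁ t` and `g₂ t` lie on the maximum locus
    have h₁ : g₁ t ∈ maxLocus ι X := (hmem g₁ t).mpr ht
    have h₂ : g₂ t ∈ maxLocus ι X := (hmem g₂ t).mpr (hg ▸ ht)
    rw [hR.stalkIdeal_eq _ h₁ n, hR.stalkIdeal_eq _ h₂ n,
      ← (iotaAt_comap_eq_and_J_comap_eq ι J hJs hu hJu hY g₁ X hX t).2 n,
      ← (iotaAt_comap_eq_and_J_comap_eq ι J hJs hu hJu hY g₂ X hX t).2 n, hg]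
  · have h₁ : g₁ t ∉ maxLocus ι X := fun h => ht ((hmem g₁ t).mp h)
    have h₂ : g₂ t ∉ maxLocus ι X := fun h => ht (hg ▸ (hmem g₂ t).mp h)
    rw [hR.stalkIdeal_eq_top _ h₁ n, hR.stalkIdeal_eq_top _ h₂ n, Ideal.map_top, Ideal.map_top]

end S5

end Summit.ResolutionOfSingularities.ResolutionOfSingularities.Theorems

end
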